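import Summits.FinalStateConjecture.FinalStateConjecture.Theorems.EIHFluxBalanceInertialRecessionStubQuasiStationarityBound

/-!
# Route EIHFluxBalance — `InertialRecession`, line `sublinear-is-free-clean-window-charges`,
# stub `stub_weightedRates`: the rate expansion of `∂₀` of a painted summand with a defect

Helper file of the worker on `stub_weightedRates` (crux `stmt-FinalStateConjecture-10166`). The
landed structural estimate `…StubQuasiStationarityBound.norm_fderiv_summand_basisVector_zero_le`
bounds the lab-time derivative of one painted Kerr–Schild summand by
`|M| G² ((B₁G + 2B₀) ν / d + B₁ G ‖ξ̇‖ / d²)`, where `ν` bounds the body rate `ω = Λ⁻¹Λ̇` modulo an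
EXACT infinitesimal stabiliser element `ω_K` of `g_{M,a}` at the rest-frame point. This file proves
the same estimate when `ω_K` satisfies the stabiliser identity only UP TO A DEFECT
`|D(g−η)(p)[ω_K p](v,w) + (g−η)(p)(ω_K v, w) + (g−η)(p)(v, ω_K w)| ≤ Δ‖v‖‖w‖`
(`norm_fderiv_summand_basisVector_zero_le_defect`: the defect enters additively as `(1+3γ)²Δ`).
It is consumed by `…StubWeightedRatesAxisChannel`, where `ω_K` is the full rotation part of `ω`
and `Δ = O(M|a|‖Λ̇e₃‖/d²)`.
-/

set_option linter.dupNamespace false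

noncomputable section

namespace Summit.FinalStateConjecture.FinalStateConjecture.Theorems.SublinearIsFree.WeightedRates

open scoped BigOperators Topology ContDiff
open Filter Set Function Literature.Geometry.Lorentzian
open Summit.FinalStateConjecture.FinalStateConjecture.Theorems
open Summit.FinalStateConjecture.FinalStateConjecture.Theorems.InertialRecession.Negative
open Summit.FinalStateConjecture.FinalStateConjecture.Theorems.SublinearIsFree.QuasiStationarity

/-! ### Scalar bookkeeping with a stabiliser defect -/

-- operator-norm instance paths on form-valued maps are slow to unify
set_option synthInstance.maxHeartbeats 200000 in
/-- **Scalar bookkeeping for the rate expansion with a stabiliser DEFECT.** As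
`abs_rate_expansion_le`, but the correction `SK` need not be an exact infinitesimal stabiliser:
if `|D(SK p)(v, w) + K(SK v, w) + K(v, SK w)| ≤ Δ` at the arguments in question, the chain-rule
value `D(−W p − e)(v, w) + K(−W v, w) + K(v, −W w)` is bounded by
`(δ₁ ν ‖p‖ + 2‖K‖ν + δ₁‖e‖) ‖v‖ ‖w‖ + Δ`. [folklore] -/
theorem abs_rate_expansion_le_defect (D : E4 →L[ℝ] E4 →L[ℝ] E4 →L[ℝ] ℝ)
    (K : E4 →L[ℝ] E4 →L[ℝ] ℝ) (W SK : E4 →L[ℝ] E4) (p e av aw : E4) {δ₁ ν Δ : ℝ}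
    (hδ₁ : ∀ u, ‖D u‖ ≤ δ₁ * ‖u‖) (hν : ∀ u, ‖(W - SK) u‖ ≤ ν * ‖u‖) (hδ0 : 0 ≤ δ₁)
    (hstab : |D (SK p) av aw + K (SK av) aw + K av (SK aw)| ≤ Δ) :
    |D (-(W p) + -e) av aw + K (-(W av)) aw + K av (-(W aw))| ≤
      (δ₁ * ν * ‖p‖ + 2 * ‖K‖ * ν + δ₁ * ‖e‖) * ‖av‖ * ‖aw‖ + Δ := by
  -- rewrite `W = T + SK`
  have hT : ∀ u, W u = (W - SK) u + SK u := fun u ↦ by simp [sub_apply]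
  have hval : D (-(W p) + -e) av aw + K (-(W av)) aw + K av (-(W aw)) =
      -(D ((W - SK) p) av aw + K ((W - SK) av) aw + K av ((W - SK) aw)) - D e av aw -
        (D (SK p) av aw + K (SK av) aw + K av (SK aw)) := by
    rw [hT p, hT av, hT aw]
    simp only [map_add, map_neg, add_apply, neg_apply]
    ring
  rw [hval]
  have h1 : |D ((W - SK) p) av aw| ≤ δ₁ * ν * ‖p‖ * ‖av‖ * ‖aw‖ := by
    refine (Real.norm_eq_abs _ ▸ (D ((W - SK) p)).le_opNorm₂ av aw).trans ?_
    have h := (hδ₁ ((W - SK) p)).trans (mul_le_mul_of_nonneg_left (hν p) hδ0)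
    have : ‖D ((W - SK) p)‖ ≤ δ₁ * ν * ‖p‖ := by nlinarith [h]
    gcongr
  have h2 : |K ((W - SK) av) aw| ≤ ‖K‖ * ν * ‖av‖ * ‖aw‖ := by
    refine (Real.norm_eq_abs _ ▸ K.le_opNorm₂ ((W - SK) av) aw).trans ?_
    have h := hν av
    have hK := norm_nonneg K
    calc ‖K‖ * ‖(W - SK) av‖ * ‖aw‖ ≤ ‖K‖ * (ν * ‖av‖) * ‖aw‖ := by gcongr
      _ = ‖K‖ * ν * ‖av‖ * ‖aw‖ := by ring
  have h3 : |K av ((W - SK) aw)| ≤ ‖K‖ * ν * ‖av‖ * ‖aw‖ := by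
    refine (Real.norm_eq_abs _ ▸ K.le_opNorm₂ av ((W - SK) aw)).trans ?_
    have h := hν aw
    calc ‖K‖ * ‖av‖ * ‖(W - SK) aw‖ ≤ ‖K‖ * ‖av‖ * (ν * ‖aw‖) := by gcongr
      _ = ‖K‖ * ν * ‖av‖ * ‖aw‖ := by ring
  have h4 : |D e av aw| ≤ δ₁ * ‖e‖ * ‖av‖ * ‖aw‖ := by
    refine (Real.norm_eq_abs _ ▸ (D e).le_opNorm₂ av aw).trans ?_
    have h := hδ₁ e
    gcongr
  calc |-(D ((W - SK) p) av aw + K ((W - SK) av) aw + K av ((W - SK) aw)) - D e av aw -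
        (D (SK p) av aw + K (SK av) aw + K av (SK aw))|
      ≤ |D ((W - SK) p) av aw| + |K ((W - SK) av) aw| + |K av ((W - SK) aw)| + |D e av aw| +
          |D (SK p) av aw + K (SK av) aw + K av (SK aw)| := by
        have := abs_add_le (D ((W - SK) p) av aw + K ((W - SK) av) aw) (K av ((W - SK) aw))
        have := abs_add_le (D ((W - SK) p) av aw) (K ((W - SK) av) aw)
        have := abs_sub (-(D ((W - SK) p) av aw + K ((W - SK) av) aw + K av ((W - SK) aw)))
          (D e av aw)
        have := abs_sub (-(D ((W - SK) p) av aw + K ((W - SK) av) aw + K av ((W - SK) aw)) -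
          D e av aw) (D (SK p) av aw + K (SK av) aw + K av (SK aw))
        rw [abs_neg] at *
        linarith
    _ ≤ δ₁ * ν * ‖p‖ * ‖av‖ * ‖aw‖ + ‖K‖ * ν * ‖av‖ * ‖aw‖ + ‖K‖ * ν * ‖av‖ * ‖aw‖ +
        δ₁ * ‖e‖ * ‖av‖ * ‖aw‖ + Δ := by linarith
    _ = (δ₁ * ν * ‖p‖ + 2 * ‖K‖ * ν + δ₁ * ‖e‖) * ‖av‖ * ‖aw‖ + Δ := by ring

/-! ### The refined structural estimate with a defect -/

-- operator-norm instance paths on form-valued maps are slow to unify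
set_option synthInstance.maxHeartbeats 200000 in
set_option maxHeartbeats 800000 in
/-- **The lab-time derivative of one painted summand, with a stabiliser defect.** As
`norm_fderiv_summand_basisVector_zero_le` (kernels `M/d` for the corrected body rate `ν` and `M/d²`
for the drift `ξ̇`), but the correction `ω_K` of the body rate `ω = Λ(t)⁻¹Λ̇(t)` at the rest-frame
point `p` is only required to satisfy the stabiliser identity UP TO A DEFECT
`|D(g−η)(p)[ω_K p](v, w) + (g−η)(p)(ω_K v, w) + (g−η)(p)(v, ω_K w)| ≤ Δ ‖v‖ ‖w‖`; the defect enters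
additively as `(1 + 3γ)² Δ`. [cite: KerrSchild1965, §3] -/
theorem norm_fderiv_summand_basisVector_zero_le_defect :
    ∃ B₀ B₁ : ℝ, 0 ≤ B₀ ∧ 0 ≤ B₁ ∧ ∀ (M a γ : ℝ) (Λ : ℝ → lorentzGroup) (ξ : ℝ → E3) (t : ℝ)
      (x : E4) (SK : E4 →L[ℝ] E4) (ν Δ : ℝ),
      ContDiff ℝ 1 (fun s ↦ ((Λ s : E4 ≃L[ℝ] E4) : E4 →L[ℝ] E4)) → ContDiff ℝ 1 ξ →
      |((Λ t : E4 ≃L[ℝ] E4) (E4.basisVector 0)) 0| ≤ γ → x 0 = t →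
      max 1 (2 * |a|) ≤ ‖E4.spatial x - ξ t‖ → 0 ≤ ν → 0 ≤ Δ →
      (∀ v w, |fderiv ℝ (fun y ↦ Kerr.bilin M a y - Minkowski.bilin)
          ((((Λ t : E4 ≃L[ℝ] E4).symm : E4 →L[ℝ] E4)) (E4.spaceEmbed (E4.spatial x - ξ t)))
          (SK ((((Λ t : E4 ≃L[ℝ] E4).symm : E4 →L[ℝ] E4)) (E4.spaceEmbed (E4.spatial x - ξ t))))
          v w +
        (Kerr.bilin M a ((((Λ t : E4 ≃L[ℝ] E4).symm : E4 →L[ℝ] E4))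
          (E4.spaceEmbed (E4.spatial x - ξ t))) - Minkowski.bilin) (SK v) w +
        (Kerr.bilin M a ((((Λ t : E4 ≃L[ℝ] E4).symm : E4 →L[ℝ] E4))
          (E4.spaceEmbed (E4.spatial x - ξ t))) - Minkowski.bilin) v (SK w)| ≤ Δ * ‖v‖ * ‖w‖) →
      (∀ u, ‖((((Λ t : E4 ≃L[ℝ] E4).symm : E4 →L[ℝ] E4)).comp
          (deriv (fun s ↦ ((Λ s : E4 ≃L[ℝ] E4) : E4 →L[ℝ] E4)) t) - SK) u‖ ≤ ν * ‖u‖) →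
      ‖fderiv ℝ (fun y : E4 ↦ boostedKerrBilin (Λ (y 0)) (E4.ofTimeSpace (y 0) (ξ (y 0))) M a y -
          Minkowski.bilin) x (E4.basisVector 0)‖ ≤
        |M| * (1 + 3 * γ) ^ 2 * ((B₁ * (1 + 3 * γ) + 2 * B₀) * ν / ‖E4.spatial x - ξ t‖ +
          B₁ * (1 + 3 * γ) * ‖deriv ξ t‖ / ‖E4.spatial x - ξ t‖ ^ 2) + (1 + 3 * γ) ^ 2 * Δ := by
  obtain ⟨B₀, hB₀, hK0⟩ := exists_norm_ksPert_le
  obtain ⟨B₁, hB₁, hK1⟩ := exists_norm_iteratedFDeriv_one_ksPert_le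
  refine ⟨B₀, B₁, hB₀, hB₁, ?_⟩
  intro M a γ Λ ξ t x SK ν Δ hΛ hξ hγ hx hd hν0 hΔ0 hstab hν
  -- names
  set Lpath : ℝ → E4 →L[ℝ] E4 := fun s ↦ ((Λ s : E4 ≃L[ℝ] E4) : E4 →L[ℝ] E4) with hLpath
  set Apath : ℝ → E4 →L[ℝ] E4 := fun s ↦ (((Λ s : E4 ≃L[ℝ] E4).symm : E4 →L[ℝ] E4)) with hApath
  set A : E4 →L[ℝ] E4 := (((Λ t : E4 ≃L[ℝ] E4).symm : E4 →L[ℝ] E4)) with hAdef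
  set L' : E4 →L[ℝ] E4 := deriv Lpath t with hL'
  set K : E4 → E4 →L[ℝ] E4 →L[ℝ] ℝ := fun y ↦ Kerr.bilin M a y - Minkowski.bilin with hKdef
  set z : E3 := E4.spatial x with hz
  set d : ℝ := ‖z - ξ t‖ with hddef
  set p : E4 := A (E4.spaceEmbed (z - ξ t)) with hpdef
  set G : ℝ := 1 + 3 * γ with hG
  -- sizes
  have hγ1 : 1 ≤ γ := (one_le_abs_lorentz_apply_zero (Λ t)).trans hγ
  have hG0 : 0 ≤ G := by rw [hG]; linarith
  have hAG : ‖A‖ ≤ G := (norm_lorentz_symm_le' (Λ t)).trans (by rw [hG]; linarith)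
  have hd1 : 1 ≤ d := (le_max_left _ _).trans hd
  have hd0 : 0 < d := one_pos.trans_le hd1
  have hσ : d ≤ E4.spatialNorm p := le_spatialNorm_restPosition (Λ t) _
  have hσ0 : 0 < E4.spatialNorm p := hd0.trans_le hσ
  have hσ' : max 1 (2 * |a|) ≤ E4.spatialNorm p := hd.trans hσ
  have hp : ‖p‖ ≤ G * d := by
    rw [hpdef]
    refine (A.le_opNorm _).trans ?_
    rw [norm_spaceEmbed]
    exact mul_le_mul_of_nonneg_right hAG (norm_nonneg _)
  -- derivatives of the paths
  have hΛ' : HasDerivAt Lpath L' t := (hΛ.differentiable one_ne_zero t).hasDerivAt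
  have hA : HasDerivAt Apath (-(A.comp (L'.comp A))) t := hasDerivAt_lorentz_symm one_ne_zero hΛ hΛ'
  have hξ' : HasDerivAt ξ (deriv ξ t) t := (hξ.differentiable one_ne_zero t).hasDerivAt
  have hKdiff : DifferentiableAt ℝ K p := differentiableAt_ksPert_of_le hσ'
  -- Kerr–Schild decay at the rest-frame point
  have hK0p : ‖K p‖ ≤ |M| * B₀ / d := by
    refine (hK0 M a p hσ').trans ?_
    exact div_le_div_of_nonneg_left (by positivity) hd0 hσ
  have hK1p : ‖iteratedFDeriv ℝ 1 K p‖ ≤ |M| * B₁ / d ^ 2 := by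
    refine (hK1 M a p hσ').trans ?_
    exact div_le_div_of_nonneg_left (by positivity) (by positivity)
      (pow_le_pow_left₀ hd0.le hσ 2)
  have hδ₁ : ∀ u, ‖fderiv ℝ K p u‖ ≤ |M| * B₁ / d ^ 2 * ‖u‖ := fun u ↦
    (norm_fderiv_apply_le_of_iteratedFDeriv_one K p u).trans
      (mul_le_mul_of_nonneg_right hK1p (norm_nonneg u))
  -- the summand is differentiable at `x`
  have hS := (contDiffAt_summand (M := M) (a := a) hΛ hξ hx hd).differentiableAt one_ne_zero
  -- pointwise bound on `D S(x)[e₀](v, w)`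
  set C : ℝ := |M| * G ^ 2 * ((B₁ * G + 2 * B₀) * ν / d + B₁ * G * ‖deriv ξ t‖ / d ^ 2) +
    G ^ 2 * Δ with hC
  have hC0 : 0 ≤ C := by positivity
  refine ContinuousLinearMap.opNorm_le_bound₂ _ hC0 fun v w ↦ ?_
  have hδ := hasDerivAt_restFrame_scalar M a hA hξ' z hKdiff v w
  have heq := fderiv_summand_basisVector_zero_apply hx hS v w hδ
  rw [Real.norm_eq_abs, heq]
  -- rewrite `A' u = −ω(Au)` with `ω = A Λ̇`
  set W : E4 →L[ℝ] E4 := A.comp L' with hW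
  have hA'u : ∀ u, (-(A.comp (L'.comp A))) u = -(W (A u)) := fun u ↦ by
    simp [hW]
  have hq' : (-(A.comp (L'.comp A))) (E4.spaceEmbed (z - ξ t)) + Apath t (E4.spaceEmbed (-deriv ξ t)) =
      -(W p) + -(A (E4.spaceEmbed (deriv ξ t))) := by
    rw [hA'u, map_neg, map_neg]
  rw [hq', hA'u, hA'u]
  have hAv : ‖A v‖ ≤ G * ‖v‖ := (A.le_opNorm v).trans (mul_le_mul_of_nonneg_right hAG (norm_nonneg _))
  have hAw : ‖A w‖ ≤ G * ‖w‖ := (A.le_opNorm w).trans (mul_le_mul_of_nonneg_right hAG (norm_nonneg _))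
  have hstab' : |fderiv ℝ K p (SK p) (A v) (A w) + K p (SK (A v)) (A w) + K p (A v) (SK (A w))| ≤
      Δ * (G * ‖v‖) * (G * ‖w‖) := by
    refine (hstab (A v) (A w)).trans ?_
    have h := mul_le_mul hAv hAw (norm_nonneg _) (by positivity)
    nlinarith [h, hΔ0]
  have key := abs_rate_expansion_le_defect (fderiv ℝ K p) (K p) W SK p
    (A (E4.spaceEmbed (deriv ξ t))) (A v) (A w) hδ₁ hν (by positivity) hstab'
  refine key.trans ?_
  -- sizes of the pieces
  have he : ‖A (E4.spaceEmbed (deriv ξ t))‖ ≤ G * ‖deriv ξ t‖ := by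
    refine (A.le_opNorm _).trans ?_
    rw [norm_spaceEmbed]
    exact mul_le_mul_of_nonneg_right hAG (norm_nonneg _)
  have hcoef : |M| * B₁ / d ^ 2 * ν * ‖p‖ + 2 * ‖K p‖ * ν + |M| * B₁ / d ^ 2 * ‖A (E4.spaceEmbed (deriv ξ t))‖
      ≤ |M| * ((B₁ * G + 2 * B₀) * ν / d + B₁ * G * ‖deriv ξ t‖ / d ^ 2) := by
    have h1 : |M| * B₁ / d ^ 2 * ν * ‖p‖ ≤ |M| * B₁ * G * ν / d := by
      have : |M| * B₁ / d ^ 2 * ν * ‖p‖ ≤ |M| * B₁ / d ^ 2 * ν * (G * d) :=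
        mul_le_mul_of_nonneg_left hp (by positivity)
      refine this.trans (le_of_eq ?_)
      field_simp
    have h2 : 2 * ‖K p‖ * ν ≤ 2 * (|M| * B₀ / d) * ν := by gcongr
    have h3 : |M| * B₁ / d ^ 2 * ‖A (E4.spaceEmbed (deriv ξ t))‖ ≤
        |M| * B₁ / d ^ 2 * (G * ‖deriv ξ t‖) := mul_le_mul_of_nonneg_left he (by positivity)
    have hsum := add_le_add (add_le_add h1 h2) h3
    refine hsum.trans (le_of_eq ?_)
    field_simp
  have hvw : ‖A v‖ * ‖A w‖ ≤ G * ‖v‖ * (G * ‖w‖) :=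
    mul_le_mul hAv hAw (norm_nonneg _) (by positivity)
  calc (|M| * B₁ / d ^ 2 * ν * ‖p‖ + 2 * ‖K p‖ * ν +
        |M| * B₁ / d ^ 2 * ‖A (E4.spaceEmbed (deriv ξ t))‖) * ‖A v‖ * ‖A w‖ +
        Δ * (G * ‖v‖) * (G * ‖w‖)
      ≤ |M| * ((B₁ * G + 2 * B₀) * ν / d + B₁ * G * ‖deriv ξ t‖ / d ^ 2) * (G * ‖v‖ * (G * ‖w‖)) +
        Δ * (G * ‖v‖) * (G * ‖w‖) := by
        rw [mul_assoc]
        have := mul_le_mul hcoef hvw (by positivity) (by positivity)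
        linarith
    _ = C * ‖v‖ * ‖w‖ := by rw [hC]; ring

-- operator-norm instance paths on form-valued maps are slow to unify
set_option synthInstance.maxHeartbeats 200000 in
/-- **Registered sub-goal form** (worker carrier `rate_expansion_defect_bound` of the crux item) of
`abs_rate_expansion_le_defect`: scalar bookkeeping of the rate expansion with a stabiliser defect.
[folklore] -/
theorem rate_expansion_defect_bound : open Literature.Geometry.Lorentzian in ∀ (D : E4 →L[ℝ] E4 →L[ℝ] E4 →L[ℝ] ℝ) (K : E4 →L[ℝ] E4 →L[ℝ] ℝ) (W SK : E4 →L[ℝ] E4) (p e av aw : E4) {δ₁ ν Δ : ℝ}, (∀ u : E4, ‖D u‖ ≤ δ₁ * ‖u‖) → (∀ u : E4, ‖(W - SK) u‖ ≤ ν * ‖u‖) → 0 ≤ δ₁ → |D (SK p) av aw + K (SK av) aw + K av (SK aw)| ≤ Δ → |D (-(W p) + -e) av aw + K (-(W av)) aw + K av (-(W aw))| ≤ (δ₁ * ν * ‖p‖ + 2 * ‖K‖ * ν + δ₁ * ‖e‖) * ‖av‖ * ‖aw‖ + Δ :=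
  fun D K W SK p e av aw _ _ _ hδ₁ hν hδ0 hstab ↦
    abs_rate_expansion_le_defect D K W SK p e av aw hδ₁ hν hδ0 hstab

end Summit.FinalStateConjecture.FinalStateConjecture.Theorems.SublinearIsFree.WeightedRates

end
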